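import Mathlib.MeasureTheory.Measure.Haar.Unique
import Summits.HodgeConjecture.HodgeConjecture.Theorems.F0P3cStCharTSTorusCompactPart        -- ★ p849333 «TOR-DATA★» HAND 1 (LH6-p01 g2): `M_c`, `mem_unitsIntegers_iff`, `isClosed_normOneUnits`
import Literature.NumberTheory.Automorphic.TateLocalZetaShells                            -- ★ `secondCountableTopology_localField`
import Literature.NumberTheory.Automorphic.UnitaryGroupBorelInduction                     -- ★ `normOneUnits`, `conjLocal_conjLocal_cm`
import Literature.NumberTheory.Automorphic.UnitaryGroupLocalFactors                       -- ★ `continuous_conjLocal`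
import Literature.NumberTheory.Automorphic.UnitaryGroupNonsplitPlace                      -- ★ `PlacesOver.subsingleton_of_smul_eq`
import HarnessLib

/-!
# F0 · P3c · line LH6 «StCharTS» — «TOR-DATA★» HAND 2: THE RAY GENERATOR `a = (ϖ, 1)` (SHELLS `aⁿ·M_c`, COVER `M = M_c·a^ℤ`) AND THE
# W-REFLECTION `ω = (σ(·)⁻¹, id)` (HAAR-PRESERVING, A MEASURABLE EMBEDDING) OF THE SPLIT TORUS `M = E_vˣ × E¹_v` IN PARAMETER FORM
# [Rogawski1990, §12.2 p. 173; L. 12.7.1 (proof) p. 191; L. 12.7.2 (proof) p. 193]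

Cell `pub/hodgecm-mathlib`, crux H413 = `stmt-HodgeConjecture-24833` (`--supports` lane, helper), route HCCMUnconditional; seat LH6-p05 (g2); «TOR-DATA★» split of
record LH6-p01 (g2) 2026-09-02T04:56:59Z (HAND 1 = ★ p849333 `F0P3cStCharTSTorusCompactPart`: the compact part `M_c`; HAND 2 = this file).  THEOREMS ONLY,
sorry-free, no definition ∕ instance ∕ notation ∕ named fact; every object is an INLINE TERM of record:
* `M := (LocalRing L v)ˣ × ↥(normOneUnits (conjLocal L c v))` (the currency of ★ p849030 ∕ p849140 ∕ p849227);
* `M_c := ((Submonoid.pi Set.univ (fun w => (w.1.adicCompletionIntegers L).toSubring.toSubmonoid)).units).prod ⊤` (`= 𝒪_vˣ × E¹_v`, ★ p849333);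
* `ω p := ((Units.map ↑(conjLocal L c v) p.1)⁻¹, p.2)` (the TERM of ★ p849140);
* the ray generator is NOT a definition: it is produced by `exists_uniformizer_units` ∕ `exists_rayGenerator` (`a = (ϖ, 1)`, `ϖ ∈ (Π_{w∣v} L_w)ˣ` with a
  uniformiser in every component), and every shell statement is proved for ANY `a = (ϖ, z)` with `|ϖ_w|_w = exp(−1)` for all `w ∣ v`.
WHAT IS PROVED (the (TOR) clauses of ★ p849140 `false_of_saRegroup_disjunct_of_ne_zero` ∕ ★ p849227 `stSupportFiniteSqInt_of_carpet` not covered by HAND 1):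
* §1 (any finite `v`): `secondCountableTopology_localRing` ∕ `_units_localRing` ∕ `_torus`, `locallyCompactSpace_normOneUnits` ∕ `_torus` (the instances a
  Haar measure on `M` and Haar uniqueness need, as theorems — invoke with `haveI`).
* §2 (any finite `v`) the W-reflection: `continuous_reflect`, `reflect_reflect` (involutive, ★ `conjLocal_conjLocal_cm`), `reflect_mul`, **`measurableEmbedding_reflect`**
  (Borel structure), `isHaarMeasure_map_reflect`, **`measurePreserving_reflect`** («`ω` preserves EVERY Haar measure on `M`»: `ω` is a continuous automorphism
  of the abelian locally compact second-countable group `M`, so `μ.map ω = c • μ` (Mathlib `isMulLeftInvariant_eq_smul`), and `c² = 1` because `ω ∘ ω = id`).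
* §3 (T4): `coe_apply_ne_zero`, `coe_zpow_apply`, `exists_uniformizer_units`; **`mem_zpow_smul_torusCompactPart_iff`** («`m ∈ (ϖ, z)ⁿ • M_c ↔ ∀ w, |m.1_w|_w =
  exp(−n)`», any finite `v`); **`pairwise_disjoint_zpow_smul_torusCompactPart`** (any finite `v`); `zpow_notMem_torusCompactPart` (`n ≠ 0 → (ϖ, z)ⁿ ∉ M_c`, the
  (SHF′)→(SHF≠0) bridge); **`exists_zpow_mul_of_nonsplit`** («`M = M_c · a^ℤ`» at a NON-SPLIT `v`: one place above `v`, ★ `PlacesOver.subsingleton_of_smul_eq`);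
  and the two packaged existence statements **`exists_rayGenerator`** (LH6-p01's interface form, token for token) and `exists_rayGenerator_shells` (same `a`,
  with `a.2 = 1`, the uniformiser reading and the shell reading recorded).
* §4 **`tor_of_nonsplit`** — HAND 1 + HAND 2 ASSEMBLED: at a non-split `v`, for the Borel structure and ANY Haar `μM` on `M`, `∃ a`, the NINE (TOR) clauses of ★
  p849227 `stSupportFiniteSqInt_of_carpet` (tree `Theorems/F0P3cStCharTSSaHead.lean` :340–:347) VERBATIM with the binder `Mc` := the term of record `M_c` — so the
  concrete (S-a) head binds `obtain ⟨a, hMc, hMccpt, hMcfin, hMcpos, hdisj, hgen, hωpres, hωemb, hωMc⟩ := tor_of_nonsplit L v hns μM` and feeds ★ §2 as is.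
HONEST LABEL: HC_CM is proved only modulo the 7 printed citations (2 remaining: hLiu418 = stmt-HodgeConjecture-24832, h413 = stmt-HodgeConjecture-24833) until
rung 0 closes; count-neutral (structure lemmas about `E_vˣ × E¹_v`; nothing about characters or representations).

## References
* [Rogawski1990] J. D. Rogawski, *Automorphic Representations of Unitary Groups in Three Variables*, Ann. of Math. Stud. 123 (1990): §1.10 p. 9 (`M = {d(α, β, ᾱ⁻¹)}`,
  `E¹`); §12.2 p. 173 (`M ≅ E* × E¹`, `W = {1, w}`, `w(α, β) = (ᾱ⁻¹, β)`); §12.7 L. 12.7.1 (proof) p. 191 (the shells `η^m 𝒪_E^*`), L. 12.7.2 (proof) p. 193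
  (Fourier analysis on `M`, `dm` a Haar measure).
* [WeilBNT1967] A. Weil, *Basic Number Theory* (1967), Ch. I §4 (structure of `K^× = ϖ^ℤ × 𝒪^×` for a `𝔭`-field `K`).
-/

set_option autoImplicit false
-- the mandated namespace has the single-problem summit's repeated segment (`HodgeConjecture.HodgeConjecture`)
set_option linter.dupNamespace false

noncomputable section

open NumberField IsDedekindDomain MeasureTheory Measure Topology Filter
open scoped NNReal ENNReal Pointwise
open Literature.NumberTheory.Automorphic Literature.NumberTheory.Automorphic.UnitaryGroup

namespace Summit.HodgeConjecture.HodgeConjecture.Cruxes.H413.F0P3cStCharTSTorusRay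

variable (L : Type) [Field L] [NumberField L] [IsCMField L] (v : HeightOneSpectrum (𝓞 ↥(maximalRealSubfield L)))

/-! ## §1 `M = E_vˣ × E¹_v` is a second-countable locally compact group (any finite `v`) -/

omit [IsCMField L] in
/-- `E_v = Π_{w∣v} L_w` is second countable (finitely many local fields, each second countable ★ `secondCountableTopology_localField`). [folklore] -/
theorem secondCountableTopology_localRing : SecondCountableTopology (LocalRing L v) := by
  haveI : ∀ w : PlacesOver L v, SecondCountableTopology (w.1.adicCompletion L) := fun w => secondCountableTopology_localField _
  infer_instance

omit [IsCMField L] in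
/-- `E_vˣ` is second countable (its topology is induced along `embedProduct` from the second countable `E_v × E_vᵐᵒᵖ`). [folklore] -/
theorem secondCountableTopology_units_localRing : SecondCountableTopology (LocalRing L v)ˣ := by
  haveI := secondCountableTopology_localRing L v
  haveI : SecondCountableTopology (LocalRing L v)ᵐᵒᵖ := MulOpposite.opHomeomorph.symm.secondCountableTopology
  exact Units.isEmbedding_embedProduct.toIsInducing.secondCountableTopology

/-- **`M = E_vˣ × E¹_v` is second countable.** [cite: Rogawski1990, §12.2 p. 173] -/
theorem secondCountableTopology_torus :
    SecondCountableTopology ((LocalRing L v)ˣ × ↥(normOneUnits (conjLocal L (IsCMField.complexConj L) v))) := by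
  haveI := secondCountableTopology_units_localRing L v
  haveI : SecondCountableTopology ↥(normOneUnits (conjLocal L (IsCMField.complexConj L) v)) := Topology.IsInducing.subtypeVal.secondCountableTopology
  infer_instance

/-- `E¹_v` is locally compact (a closed subgroup ★ `isClosed_normOneUnits` of the locally compact `E_vˣ`). [cite: Rogawski1990, §1.10 p. 9] -/
theorem locallyCompactSpace_normOneUnits : LocallyCompactSpace ↥(normOneUnits (conjLocal L (IsCMField.complexConj L) v)) :=
  (F0P3cStCharTSTorusCompactPart.isClosed_normOneUnits _ (continuous_conjLocal L (IsCMField.complexConj L) v)).locallyCompactSpace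

/-- **`M = E_vˣ × E¹_v` is locally compact** (so it carries Haar measures, Mathlib `MeasureTheory.Measure.haar`). [cite: Rogawski1990, §12.7 L. 12.7.2 (proof) p. 193] -/
theorem locallyCompactSpace_torus :
    LocallyCompactSpace ((LocalRing L v)ˣ × ↥(normOneUnits (conjLocal L (IsCMField.complexConj L) v))) := by
  haveI := locallyCompactSpace_normOneUnits L v
  infer_instance

/-! ## §2 The W-reflection `ω(u, z) = (σ(u)⁻¹, z)` (any finite `v`) -/

/-- `ω` is continuous (★ `continuous_conjLocal`; inversion is continuous on `E_vˣ`). [cite: Rogawski1990, §12.2 p. 173] -/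
theorem continuous_reflect : Continuous (fun p : ((LocalRing L v)ˣ × ↥(normOneUnits (conjLocal L (IsCMField.complexConj L) v))) => ((Units.map ((conjLocal L (IsCMField.complexConj L) v : LocalRing L v →+* LocalRing L v) : LocalRing L v →* LocalRing L v) p.1)⁻¹, p.2)) :=
  (((Continuous.units_map _ (continuous_conjLocal L (IsCMField.complexConj L) v)).comp continuous_fst).inv).prodMk continuous_snd

/-- **`ω` is an involution**: `σ(σ(u)⁻¹)⁻¹ = σ(σ(u)) = u` (★ `conjLocal_conjLocal_cm`). [cite: Rogawski1990, §12.2 p. 173] -/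
theorem reflect_reflect (p : ((LocalRing L v)ˣ × ↥(normOneUnits (conjLocal L (IsCMField.complexConj L) v)))) : (fun p : ((LocalRing L v)ˣ × ↥(normOneUnits (conjLocal L (IsCMField.complexConj L) v))) => ((Units.map ((conjLocal L (IsCMField.complexConj L) v : LocalRing L v →+* LocalRing L v) : LocalRing L v →* LocalRing L v) p.1)⁻¹, p.2)) ((fun p : ((LocalRing L v)ˣ × ↥(normOneUnits (conjLocal L (IsCMField.complexConj L) v))) => ((Units.map ((conjLocal L (IsCMField.complexConj L) v : LocalRing L v →+* LocalRing L v) : LocalRing L v →* LocalRing L v) p.1)⁻¹, p.2)) p) = p := by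
  refine Prod.ext (Units.ext ?_) rfl
  simp only [map_inv, inv_inv, Units.coe_map, MonoidHom.coe_coe, conjLocal_conjLocal_cm]

/-- `ω` is multiplicative (`M` is commutative, `σ` is a ring homomorphism). [cite: Rogawski1990, §12.2 p. 173] -/
theorem reflect_mul (p q : ((LocalRing L v)ˣ × ↥(normOneUnits (conjLocal L (IsCMField.complexConj L) v)))) : (fun p : ((LocalRing L v)ˣ × ↥(normOneUnits (conjLocal L (IsCMField.complexConj L) v))) => ((Units.map ((conjLocal L (IsCMField.complexConj L) v : LocalRing L v →+* LocalRing L v) : LocalRing L v →* LocalRing L v) p.1)⁻¹, p.2)) (p * q) = (fun p : ((LocalRing L v)ˣ × ↥(normOneUnits (conjLocal L (IsCMField.complexConj L) v))) => ((Units.map ((conjLocal L (IsCMField.complexConj L) v : LocalRing L v →+* LocalRing L v) : LocalRing L v →* LocalRing L v) p.1)⁻¹, p.2)) p * (fun p : ((LocalRing L v)ˣ × ↥(normOneUnits (conjLocal L (IsCMField.complexConj L) v))) => ((Units.map ((conjLocal L (IsCMField.complexConj L) v : LocalRing L v →+* LocalRing L v) : LocalRing L v →* LocalRing L v) p.1)⁻¹,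 p.2)) q := by
  refine Prod.ext ?_ rfl
  simp only [Prod.fst_mul, map_mul, mul_inv]

/-- **(T5a) `ω` is a measurable embedding** for the Borel structure on `M` (a homeomorphism, being a continuous involution) — the (TOR) clause «`MeasurableEmbedding ω`»
of ★ p849140 ∕ ★ p849227. [cite: Rogawski1990, §12.7 L. 12.7.2 (proof) p. 193] -/
theorem measurableEmbedding_reflect [MeasurableSpace ((LocalRing L v)ˣ × ↥(normOneUnits (conjLocal L (IsCMField.complexConj L) v)))] [BorelSpace ((LocalRing L v)ˣ × ↥(normOneUnits (conjLocal L (IsCMField.complexConj L) v)))] : MeasurableEmbedding (fun p : ((LocalRing L v)ˣ × ↥(normOneUnits (conjLocal L (IsCMField.complexConj L) v))) => ((Units.map ((conjLocal L (IsCMField.complexConj L) v : LocalRing L v →+* LocalRing L v) : LocalRing L v →* LocalRing L v) p.1)⁻¹, p.2)) :=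
  (Homeomorph.mk ⟨(fun p : ((LocalRing L v)ˣ × ↥(normOneUnits (conjLocal L (IsCMField.complexConj L) v))) => ((Units.map ((conjLocal L (IsCMField.complexConj L) v : LocalRing L v →+* LocalRing L v) : LocalRing L v →* LocalRing L v) p.1)⁻¹, p.2)), (fun p : ((LocalRing L v)ˣ × ↥(normOneUnits (conjLocal L (IsCMField.complexConj L) v))) => ((Units.map ((conjLocal L (IsCMField.complexConj L) v : LocalRing L v →+* LocalRing L v) : LocalRing L v →* LocalRing L v) p.1)⁻¹, p.2)), reflect_reflect L v, reflect_reflect L v⟩ (continuous_reflect L v) (continuous_reflect L v)).measurableEmbedding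

/-- The image of a Haar measure on `M` under `ω` is a Haar measure (`ω` is a topological-group automorphism of `M`). [cite: Rogawski1990, §12.7 L. 12.7.2 (proof) p. 193] -/
theorem isHaarMeasure_map_reflect [MeasurableSpace ((LocalRing L v)ˣ × ↥(normOneUnits (conjLocal L (IsCMField.complexConj L) v)))] [BorelSpace ((LocalRing L v)ˣ × ↥(normOneUnits (conjLocal L (IsCMField.complexConj L) v)))] (μ : Measure ((LocalRing L v)ˣ × ↥(normOneUnits (conjLocal L (IsCMField.complexConj L) v)))) [μ.IsHaarMeasure] : (μ.map (fun p : ((LocalRing L v)ˣ × ↥(normOneUnits (conjLocal L (IsCMField.complexConj L) v))) => ((Units.map ((conjLocal L (IsCMField.complexConj L) v : LocalRing L v →+* LocalRing L v) : LocalRing L v →* LocalRing L v) p.1)⁻¹, p.2))).IsHaarMeasure :=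
  ContinuousMulEquiv.isHaarMeasure_map μ
    ({ toFun := (fun p : ((LocalRing L v)ˣ × ↥(normOneUnits (conjLocal L (IsCMField.complexConj L) v))) => ((Units.map ((conjLocal L (IsCMField.complexConj L) v : LocalRing L v →+* LocalRing L v) : LocalRing L v →* LocalRing L v) p.1)⁻¹, p.2))
       invFun := (fun p : ((LocalRing L v)ˣ × ↥(normOneUnits (conjLocal L (IsCMField.complexConj L) v))) => ((Units.map ((conjLocal L (IsCMField.complexConj L) v : LocalRing L v →+* LocalRing L v) : LocalRing L v →* LocalRing L v) p.1)⁻¹, p.2))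
       left_inv := reflect_reflect L v
       right_inv := reflect_reflect L v
       map_mul' := reflect_mul L v
       continuous_toFun := continuous_reflect L v
       continuous_invFun := continuous_reflect L v } : ((LocalRing L v)ˣ × ↥(normOneUnits (conjLocal L (IsCMField.complexConj L) v))) ≃ₜ* ((LocalRing L v)ˣ × ↥(normOneUnits (conjLocal L (IsCMField.complexConj L) v))))

/-- **(T5b) `ω` PRESERVES EVERY HAAR MEASURE ON `M`**: `μ.map ω` is a Haar measure, so `μ.map ω = c • μ` (Haar uniqueness on the second-countable locally compact
group `M`, Mathlib `isMulLeftInvariant_eq_smul`); applying `ω` twice gives `μ = c² • μ`, whence `c = 1` (evaluate on a compact set of positive finite measure) —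
the argument of Mathlib's `IsHaarMeasure.isInvInvariant_of_regular`.  This is the (TOR) clause «`MeasurePreserving ω μM μM`» of ★ p849140 ∕ ★ p849227 for ANY
Borel Haar measure `μM` on `M`, at ANY finite `v`. [cite: Rogawski1990, §12.7 L. 12.7.2 (proof) p. 193; §12.2 p. 173] -/
theorem measurePreserving_reflect [MeasurableSpace ((LocalRing L v)ˣ × ↥(normOneUnits (conjLocal L (IsCMField.complexConj L) v)))] [BorelSpace ((LocalRing L v)ˣ × ↥(normOneUnits (conjLocal L (IsCMField.complexConj L) v)))] (μ : Measure ((LocalRing L v)ˣ × ↥(normOneUnits (conjLocal L (IsCMField.complexConj L) v)))) [μ.IsHaarMeasure] : MeasurePreserving (fun p : ((LocalRing L v)ˣ × ↥(normOneUnits (conjLocal L (IsCMField.complexConj L) v))) => ((Units.map ((conjLocal L (IsCMField.complexConj L) v : LocalRing L v →+* LocalRing L v) : LocalRing L v →* LocalRing L v) p.1)⁻¹, p.2)) μ μ := by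
  haveI := locallyCompactSpace_torus L v
  haveI := secondCountableTopology_torus L v
  haveI := isHaarMeasure_map_reflect L v μ
  have hωm : Measurable (fun p : ((LocalRing L v)ˣ × ↥(normOneUnits (conjLocal L (IsCMField.complexConj L) v))) => ((Units.map ((conjLocal L (IsCMField.complexConj L) v : LocalRing L v →+* LocalRing L v) : LocalRing L v →* LocalRing L v) p.1)⁻¹, p.2)) := (continuous_reflect L v).measurable
  have hωω : ((fun p : ((LocalRing L v)ˣ × ↥(normOneUnits (conjLocal L (IsCMField.complexConj L) v))) => ((Units.map ((conjLocal L (IsCMField.complexConj L) v : LocalRing L v →+* LocalRing L v) : LocalRing L v →* LocalRing L v) p.1)⁻¹, p.2)) ∘ (fun p : ((LocalRing L v)ˣ × ↥(normOneUnits (conjLocal L (IsCMField.complexConj L) v))) => ((Units.map ((conjLocal L (IsCMField.complexConj L) v : LocalRing L v →+* LocalRing L v) : LocalRing L v →* LocalRing L v) p.1)⁻¹, p.2))) = id := by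
    funext p
    exact reflect_reflect L v p
  -- Haar uniqueness: `μ.map ω = c • μ`
  let c : ℝ≥0∞ := (μ.map (fun p : ((LocalRing L v)ˣ × ↥(normOneUnits (conjLocal L (IsCMField.complexConj L) v))) => ((Units.map ((conjLocal L (IsCMField.complexConj L) v : LocalRing L v →+* LocalRing L v) : LocalRing L v →* LocalRing L v) p.1)⁻¹, p.2))).haarScalarFactor μ
  have hc : μ.map (fun p : ((LocalRing L v)ˣ × ↥(normOneUnits (conjLocal L (IsCMField.complexConj L) v))) => ((Units.map ((conjLocal L (IsCMField.complexConj L) v : LocalRing L v →+* LocalRing L v) : LocalRing L v →* LocalRing L v) p.1)⁻¹, p.2)) = c • μ := isMulLeftInvariant_eq_smul (μ.map (fun p : ((LocalRing L v)ˣ × ↥(normOneUnits (conjLocal L (IsCMField.complexConj L) v))) => ((Units.map ((conjLocal L (IsCMField.complexConj L) v : LocalRing L v →+* LocalRing L v) : LocalRing L v →* LocalRing L v) p.1)⁻¹, p.2))) μ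
  -- `ω` is an involution, so `μ = c² • μ`
  have h2 : (μ.map (fun p : ((LocalRing L v)ˣ × ↥(normOneUnits (conjLocal L (IsCMField.complexConj L) v))) => ((Units.map ((conjLocal L (IsCMField.complexConj L) v : LocalRing L v →+* LocalRing L v) : LocalRing L v →* LocalRing L v) p.1)⁻¹, p.2))).map (fun p : ((LocalRing L v)ˣ × ↥(normOneUnits (conjLocal L (IsCMField.complexConj L) v))) => ((Units.map ((conjLocal L (IsCMField.complexConj L) v : LocalRing L v →+* LocalRing L v) : LocalRing L v →* LocalRing L v) p.1)⁻¹, p.2)) = c ^ 2 • μ := by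
    rw [hc, Measure.map_smul, hc, smul_smul, pow_two]
  rw [Measure.map_map hωm hωm, hωω, Measure.map_id] at h2
  -- evaluate on a compact set with non-empty interior: `c² = 1`, so `c = 1`
  have K : TopologicalSpace.PositiveCompacts ((LocalRing L v)ˣ × ↥(normOneUnits (conjLocal L (IsCMField.complexConj L) v))) := Classical.arbitrary _
  have hK : c ^ 2 * μ K = 1 ^ 2 * μ K := by
    conv_rhs => rw [h2]
    simp
  have hc2 : c ^ 2 = 1 ^ 2 :=
    (ENNReal.mul_left_inj (measure_pos_of_nonempty_interior _ K.interior_nonempty).ne' K.isCompact.measure_lt_top.ne).1 hK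
  have hc1 : c = 1 := (ENNReal.pow_right_strictMono two_ne_zero).injective hc2
  refine ⟨hωm, ?_⟩
  rw [hc, hc1, one_smul]

/-! ## §3 (T4) The ray generator `a = (ϖ, z)`: shells `aⁿ·M_c = {|α|_w = exp(−n)} × E¹`, pairwise disjoint, covering `M` at a non-split `v` -/

omit [IsCMField L] in
/-- A unit of `E_v = Π_{w∣v} L_w` has non-zero components. [folklore] -/
theorem coe_apply_ne_zero (u : (LocalRing L v)ˣ) (w : PlacesOver L v) : (u : LocalRing L v) w ≠ 0 := by
  have h1 : ((u⁻¹ : (LocalRing L v)ˣ) : LocalRing L v) w * (u : LocalRing L v) w = 1 := by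
    rw [← Pi.mul_apply, Units.inv_mul, Pi.one_apply]
  exact right_ne_zero_of_mul_eq_one h1

omit [IsCMField L] in
/-- Components of integer powers of units of `Π_{w∣v} L_w`: `(uⁿ)_w = (u_w)ⁿ` (through the evaluation homomorphism at `w` on units). [folklore] -/
theorem coe_zpow_apply (u : (LocalRing L v)ˣ) (n : ℤ) (w : PlacesOver L v) :
    ((u ^ n : (LocalRing L v)ˣ) : LocalRing L v) w = ((u : LocalRing L v) w) ^ n := by
  have h : ∀ x : (LocalRing L v)ˣ, (x : LocalRing L v) w =
      ((Units.map ((Pi.evalRingHom (fun w' : PlacesOver L v => w'.1.adicCompletion L) w :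
        LocalRing L v →+* w.1.adicCompletion L) : LocalRing L v →* w.1.adicCompletion L) x : (w.1.adicCompletion L)ˣ) : w.1.adicCompletion L) :=
    fun x => rfl
  rw [h, h, map_zpow, Units.val_zpow_eq_zpow_val]

omit [IsCMField L] in
/-- Valuations of the components of integer powers of units: `|(uⁿ)_w|_w = |u_w|_wⁿ`. [folklore] -/
theorem valued_coe_zpow_apply (u : (LocalRing L v)ˣ) (n : ℤ) (w : PlacesOver L v) :
    Valued.v (((u ^ n : (LocalRing L v)ˣ) : LocalRing L v) w) = Valued.v ((u : LocalRing L v) w) ^ n := by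
  rw [coe_zpow_apply, map_zpow₀]

omit [IsCMField L] in
/-- **A uniformiser unit `ϖ ∈ E_vˣ`**: a unit of `Π_{w∣v} L_w` whose every component is a uniformiser of `L_w` (`|ϖ_w|_w = exp(−1)`; Mathlib
`valuation_exists_uniformizer` in each factor). [cite: WeilBNT1967, Ch. I §4] [cite: Rogawski1990, §12.7 L. 12.7.1 (proof) p. 191] -/
theorem exists_uniformizer_units :
    ∃ ϖ : (LocalRing L v)ˣ, ∀ w : PlacesOver L v, Valued.v ((ϖ : LocalRing L v) w) = WithZero.exp (-1 : ℤ) := by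
  have hπ : ∀ w : PlacesOver L v, ∃ π : w.1.adicCompletion L, Valued.v π = WithZero.exp (-1 : ℤ) := fun w => by
    obtain ⟨π, hπ⟩ := w.1.valuation_exists_uniformizer L
    exact ⟨(π : w.1.adicCompletion L), by rw [HeightOneSpectrum.valuedAdicCompletion_eq_valuation', hπ]⟩
  choose π hπ using hπ
  have hπ0 : ∀ w, π w ≠ 0 := fun w h0 => by
    have h := hπ w
    rw [h0, map_zero] at h
    exact WithZero.zero_ne_coe h
  exact ⟨⟨π, fun w => (π w)⁻¹, funext fun w => mul_inv_cancel₀ (hπ0 w), funext fun w => inv_mul_cancel₀ (hπ0 w)⟩, hπ⟩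

/-- **THE SHELLS `(ϖ, z)ⁿ · M_c = {m : |m.1_w|_w = exp(−n) for all w ∣ v}`** for ANY `ϖ ∈ E_vˣ` with `|ϖ_w|_w = exp(−1)` at every `w ∣ v` and any `z ∈ E¹_v`
(print: `η^n 𝒪_E^* × E¹`; membership in `M_c` is `|·|_w = 1` at every `w`, ★ `mem_unitsIntegers_iff`). Any finite `v`. [cite: Rogawski1990, §12.7 L. 12.7.1 (proof) p. 191; §12.2 p. 173] -/
theorem mem_zpow_smul_torusCompactPart_iff (ϖ : (LocalRing L v)ˣ) (hϖ : ∀ w : PlacesOver L v, Valued.v ((ϖ : LocalRing L v) w) = WithZero.exp (-1 : ℤ))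
    (z : ↥(normOneUnits (conjLocal L (IsCMField.complexConj L) v))) (n : ℤ) (m : ((LocalRing L v)ˣ × ↥(normOneUnits (conjLocal L (IsCMField.complexConj L) v)))) :
    m ∈ ((((ϖ, z) : ((LocalRing L v)ˣ × ↥(normOneUnits (conjLocal L (IsCMField.complexConj L) v)))) ^ n) •
      ((((Submonoid.pi Set.univ (fun w : PlacesOver L v => (w.1.adicCompletionIntegers L).toSubring.toSubmonoid)).units.prod (⊤ : Subgroup ↥(normOneUnits (conjLocal L (IsCMField.complexConj L) v)))) : Subgroup ((LocalRing L v)ˣ × ↥(normOneUnits (conjLocal L (IsCMField.complexConj L) v)))) : Set ((LocalRing L v)ˣ × ↥(normOneUnits (conjLocal L (IsCMField.complexConj L) v))))) ↔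
      ∀ w : PlacesOver L v, Valued.v ((m.1 : LocalRing L v) w) = WithZero.exp (-n) := by
  rw [Set.mem_smul_set_iff_inv_smul_mem, smul_eq_mul, SetLike.mem_coe, Subgroup.mem_prod]
  simp only [Subgroup.mem_top, and_true]
  rw [F0P3cStCharTSTorusCompactPart.mem_unitsIntegers_iff]
  refine forall_congr' fun w => ?_
  have hfst : ((((ϖ, z) : ((LocalRing L v)ˣ × ↥(normOneUnits (conjLocal L (IsCMField.complexConj L) v)))) ^ n)⁻¹ * m).1 = (ϖ ^ n)⁻¹ * m.1 := rfl
  rw [hfst, ← zpow_neg, Units.val_mul, Pi.mul_apply, map_mul, valued_coe_zpow_apply, hϖ, ← WithZero.exp_zsmul, smul_eq_mul, mul_neg, mul_one, neg_neg,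
    mul_eq_one_iff_inv_eq₀ WithZero.exp_ne_zero, ← WithZero.exp_neg, eq_comm]

/-- **THE SHELLS ARE PAIRWISE DISJOINT** (`n ↦ (ϖ, z)ⁿ · M_c`; read the valuation at one place above `v`). Any finite `v`. [cite: Rogawski1990, §12.7 L. 12.7.1 (proof) p. 191] -/
theorem pairwise_disjoint_zpow_smul_torusCompactPart (ϖ : (LocalRing L v)ˣ) (hϖ : ∀ w : PlacesOver L v, Valued.v ((ϖ : LocalRing L v) w) = WithZero.exp (-1 : ℤ))
    (z : ↥(normOneUnits (conjLocal L (IsCMField.complexConj L) v))) :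
    Pairwise (Function.onFun Disjoint fun n : ℤ => ((((ϖ, z) : ((LocalRing L v)ˣ × ↥(normOneUnits (conjLocal L (IsCMField.complexConj L) v)))) ^ n) •
      ((((Submonoid.pi Set.univ (fun w : PlacesOver L v => (w.1.adicCompletionIntegers L).toSubring.toSubmonoid)).units.prod (⊤ : Subgroup ↥(normOneUnits (conjLocal L (IsCMField.complexConj L) v)))) : Subgroup ((LocalRing L v)ˣ × ↥(normOneUnits (conjLocal L (IsCMField.complexConj L) v)))) : Set ((LocalRing L v)ˣ × ↥(normOneUnits (conjLocal L (IsCMField.complexConj L) v)))))) := by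
  intro i j hij
  rw [Function.onFun_apply, Set.disjoint_left]
  intro m hi hj
  obtain ⟨w⟩ := (inferInstance : Nonempty (PlacesOver L v))
  have h1 := ((mem_zpow_smul_torusCompactPart_iff L v ϖ hϖ z i m).1 hi) w
  have h2 := ((mem_zpow_smul_torusCompactPart_iff L v ϖ hϖ z j m).1 hj) w
  rw [h1, WithZero.exp_inj, neg_inj] at h2
  exact hij h2

/-- **`(ϖ, z)ⁿ ∉ M_c` for `n ≠ 0`** (the shell of index `n` misses the unit shell `M_c = (ϖ, z)⁰ · M_c`); the bridge from a socket phrased over «every shell `m₀ • M_c`,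
`m₀ ∉ M_c`» to the shells `aⁿ • M_c`, `n ≠ 0`. Any finite `v`. [cite: Rogawski1990, §12.7 L. 12.7.1 (proof) p. 191] -/
theorem zpow_notMem_torusCompactPart (ϖ : (LocalRing L v)ˣ) (hϖ : ∀ w : PlacesOver L v, Valued.v ((ϖ : LocalRing L v) w) = WithZero.exp (-1 : ℤ))
    (z : ↥(normOneUnits (conjLocal L (IsCMField.complexConj L) v))) {n : ℤ} (hn : n ≠ 0) :
    (((ϖ, z) : ((LocalRing L v)ˣ × ↥(normOneUnits (conjLocal L (IsCMField.complexConj L) v)))) ^ n) ∉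
      (((Submonoid.pi Set.univ (fun w : PlacesOver L v => (w.1.adicCompletionIntegers L).toSubring.toSubmonoid)).units.prod (⊤ : Subgroup ↥(normOneUnits (conjLocal L (IsCMField.complexConj L) v)))) : Subgroup ((LocalRing L v)ˣ × ↥(normOneUnits (conjLocal L (IsCMField.complexConj L) v)))) := by
  intro hmem
  have hdisj := pairwise_disjoint_zpow_smul_torusCompactPart L v ϖ hϖ z hn
  rw [Function.onFun_apply, zpow_zero, one_smul, Set.disjoint_left] at hdisj
  refine hdisj ?_ hmem
  have h := Set.smul_mem_smul_set (a := (((ϖ, z) : ((LocalRing L v)ˣ × ↥(normOneUnits (conjLocal L (IsCMField.complexConj L) v)))) ^ n))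
    (SetLike.mem_coe.2 (Subgroup.one_mem (((Submonoid.pi Set.univ (fun w : PlacesOver L v => (w.1.adicCompletionIntegers L).toSubring.toSubmonoid)).units.prod (⊤ : Subgroup ↥(normOneUnits (conjLocal L (IsCMField.complexConj L) v)))))))
  rwa [smul_eq_mul, mul_one] at h

/-- **THE SHELLS COVER `M` AT A NON-SPLIT `v`**: every `m ∈ M` is `(ϖ, z)ⁿ · u` with `u ∈ M_c`, `n = −log |m.1_w|_w` at the ONE place `w` above `v`
(★ `PlacesOver.subsingleton_of_smul_eq`) — print's `M = M_c · a^ℤ`, `E* = ϖ^ℤ × 𝒪^*`. [cite: WeilBNT1967, Ch. I §4] [cite: Rogawski1990, §12.7 L. 12.7.2 (proof) p. 193] -/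
theorem exists_zpow_mul_of_nonsplit (hns : ∀ w : PlacesOver L v, IsCMField.complexConj L • w.1 = w.1)
    (ϖ : (LocalRing L v)ˣ) (hϖ : ∀ w : PlacesOver L v, Valued.v ((ϖ : LocalRing L v) w) = WithZero.exp (-1 : ℤ))
    (z : ↥(normOneUnits (conjLocal L (IsCMField.complexConj L) v))) (m : ((LocalRing L v)ˣ × ↥(normOneUnits (conjLocal L (IsCMField.complexConj L) v)))) :
    ∃ (n : ℤ) (u : ((LocalRing L v)ˣ × ↥(normOneUnits (conjLocal L (IsCMField.complexConj L) v)))),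
      u ∈ (((Submonoid.pi Set.univ (fun w : PlacesOver L v => (w.1.adicCompletionIntegers L).toSubring.toSubmonoid)).units.prod (⊤ : Subgroup ↥(normOneUnits (conjLocal L (IsCMField.complexConj L) v)))) : Subgroup ((LocalRing L v)ˣ × ↥(normOneUnits (conjLocal L (IsCMField.complexConj L) v)))) ∧
        m = (((ϖ, z) : ((LocalRing L v)ˣ × ↥(normOneUnits (conjLocal L (IsCMField.complexConj L) v)))) ^ n) * u := by
  obtain ⟨w⟩ := (inferInstance : Nonempty (PlacesOver L v))
  haveI := PlacesOver.subsingleton_of_smul_eq (IsCMField.complexConj L) (IsCMField.complexConj_ne_one L) w (hns w)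
  have hv0 : Valued.v ((m.1 : LocalRing L v) w) ≠ 0 := (Valuation.ne_zero_iff _).2 (coe_apply_ne_zero L v m.1 w)
  set k : ℤ := WithZero.log (Valued.v ((m.1 : LocalRing L v) w)) with hk
  have hvk : Valued.v ((m.1 : LocalRing L v) w) = WithZero.exp k := by rw [hk, WithZero.exp_log hv0]
  have hmem : m ∈ ((((ϖ, z) : ((LocalRing L v)ˣ × ↥(normOneUnits (conjLocal L (IsCMField.complexConj L) v)))) ^ (-k)) •
      ((((Submonoid.pi Set.univ (fun w : PlacesOver L v => (w.1.adicCompletionIntegers L).toSubring.toSubmonoid)).units.prod (⊤ : Subgroup ↥(normOneUnits (conjLocal L (IsCMField.complexConj L) v)))) : Subgroup ((LocalRing L v)ˣ × ↥(normOneUnits (conjLocal L (IsCMField.complexConj L) v)))) : Set ((LocalRing L v)ˣ × ↥(normOneUnits (conjLocal L (IsCMField.complexConj L) v))))) :=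
    (mem_zpow_smul_torusCompactPart_iff L v ϖ hϖ z (-k) m).2 fun w' => by rw [Subsingleton.elim w' w, hvk, neg_neg]
  obtain ⟨u, hu, hum⟩ := Set.mem_smul_set.1 hmem
  exact ⟨-k, u, hu, by rw [← hum, smul_eq_mul]⟩

/-- **(T4) THE RAY GENERATOR — LH6-p01 (g2)'s interface form, token for token**: at a NON-SPLIT `v` there is `a ∈ M` (namely `a = (ϖ, 1)`) whose shells `aⁿ · M_c`
are pairwise disjoint and cover `M`: `M = ⨆_{n ∈ ℤ} aⁿ · M_c`.  This discharges the (TOR) binders `(a)`, «pairwise disjoint shells», «`∀ m, ∃ n u, u ∈ M_c ∧ m = aⁿ u`»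
of ★ p849140 ∕ ★ p849227. [cite: Rogawski1990, §12.7 L. 12.7.1 (proof) p. 191; L. 12.7.2 (proof) p. 193; §12.2 p. 173] [cite: WeilBNT1967, Ch. I §4] -/
theorem exists_rayGenerator (hns : ∀ w : PlacesOver L v, IsCMField.complexConj L • w.1 = w.1) :
    ∃ a : ((LocalRing L v)ˣ × ↥(normOneUnits (conjLocal L (IsCMField.complexConj L) v))),
      Pairwise (Function.onFun Disjoint fun n : ℤ => (a ^ n) •
        ((((Submonoid.pi Set.univ (fun w : PlacesOver L v => (w.1.adicCompletionIntegers L).toSubring.toSubmonoid)).units.prod (⊤ : Subgroup ↥(normOneUnits (conjLocal L (IsCMField.complexConj L) v)))) : Subgroup ((LocalRing L v)ˣ × ↥(normOneUnits (conjLocal L (IsCMField.complexConj L) v)))) : Set ((LocalRing L v)ˣ × ↥(normOneUnits (conjLocal L (IsCMField.complexConj L) v))))) ∧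
      ∀ m : ((LocalRing L v)ˣ × ↥(normOneUnits (conjLocal L (IsCMField.complexConj L) v))),
        ∃ (n : ℤ) (u : ((LocalRing L v)ˣ × ↥(normOneUnits (conjLocal L (IsCMField.complexConj L) v)))),
          u ∈ (((Submonoid.pi Set.univ (fun w : PlacesOver L v => (w.1.adicCompletionIntegers L).toSubring.toSubmonoid)).units.prod (⊤ : Subgroup ↥(normOneUnits (conjLocal L (IsCMField.complexConj L) v)))) : Subgroup ((LocalRing L v)ˣ × ↥(normOneUnits (conjLocal L (IsCMField.complexConj L) v)))) ∧
            m = a ^ n * u := by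
  obtain ⟨ϖ, hϖ⟩ := exists_uniformizer_units L v
  exact ⟨(ϖ, 1), pairwise_disjoint_zpow_smul_torusCompactPart L v ϖ hϖ 1, exists_zpow_mul_of_nonsplit L v hns ϖ hϖ 1⟩

/-- **(T4′) THE RAY GENERATOR WITH ITS READINGS**: the same `a = (ϖ, 1)` with, in addition, `a.2 = 1`, the uniformiser reading `|ϖ_w|_w = exp(−1)`, the shell
reading `m ∈ aⁿ · M_c ↔ ∀ w, |m.1_w|_w = exp(−n)`, and `aⁿ ∉ M_c` for `n ≠ 0` — for consumers that phrase (SHF) over shells `m₀ • M_c`, `m₀ ∉ M_c`, or over valuation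
spheres. [cite: Rogawski1990, §12.7 L. 12.7.1 (proof) p. 191; L. 12.7.2 (proof) p. 193] [cite: WeilBNT1967, Ch. I §4] -/
theorem exists_rayGenerator_shells (hns : ∀ w : PlacesOver L v, IsCMField.complexConj L • w.1 = w.1) :
    ∃ a : ((LocalRing L v)ˣ × ↥(normOneUnits (conjLocal L (IsCMField.complexConj L) v))),
      a.2 = 1 ∧ (∀ w : PlacesOver L v, Valued.v ((a.1 : LocalRing L v) w) = WithZero.exp (-1 : ℤ)) ∧
      (∀ (n : ℤ) (m : ((LocalRing L v)ˣ × ↥(normOneUnits (conjLocal L (IsCMField.complexConj L) v)))),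
        m ∈ (a ^ n) • ((((Submonoid.pi Set.univ (fun w : PlacesOver L v => (w.1.adicCompletionIntegers L).toSubring.toSubmonoid)).units.prod (⊤ : Subgroup ↥(normOneUnits (conjLocal L (IsCMField.complexConj L) v)))) : Subgroup ((LocalRing L v)ˣ × ↥(normOneUnits (conjLocal L (IsCMField.complexConj L) v)))) : Set ((LocalRing L v)ˣ × ↥(normOneUnits (conjLocal L (IsCMField.complexConj L) v)))) ↔
          ∀ w : PlacesOver L v, Valued.v ((m.1 : LocalRing L v) w) = WithZero.exp (-n)) ∧
      Pairwise (Function.onFun Disjoint fun n : ℤ => (a ^ n) •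
        ((((Submonoid.pi Set.univ (fun w : PlacesOver L v => (w.1.adicCompletionIntegers L).toSubring.toSubmonoid)).units.prod (⊤ : Subgroup ↥(normOneUnits (conjLocal L (IsCMField.complexConj L) v)))) : Subgroup ((LocalRing L v)ˣ × ↥(normOneUnits (conjLocal L (IsCMField.complexConj L) v)))) : Set ((LocalRing L v)ˣ × ↥(normOneUnits (conjLocal L (IsCMField.complexConj L) v))))) ∧
      (∀ m : ((LocalRing L v)ˣ × ↥(normOneUnits (conjLocal L (IsCMField.complexConj L) v))),
        ∃ (n : ℤ) (u : ((LocalRing L v)ˣ × ↥(normOneUnits (conjLocal L (IsCMField.complexConj L) v)))),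
          u ∈ (((Submonoid.pi Set.univ (fun w : PlacesOver L v => (w.1.adicCompletionIntegers L).toSubring.toSubmonoid)).units.prod (⊤ : Subgroup ↥(normOneUnits (conjLocal L (IsCMField.complexConj L) v)))) : Subgroup ((LocalRing L v)ˣ × ↥(normOneUnits (conjLocal L (IsCMField.complexConj L) v)))) ∧
            m = a ^ n * u) ∧
      (∀ n : ℤ, n ≠ 0 → a ^ n ∉ (((Submonoid.pi Set.univ (fun w : PlacesOver L v => (w.1.adicCompletionIntegers L).toSubring.toSubmonoid)).units.prod (⊤ : Subgroup ↥(normOneUnits (conjLocal L (IsCMField.complexConj L) v)))) : Subgroup ((LocalRing L v)ˣ × ↥(normOneUnits (conjLocal L (IsCMField.complexConj L) v))))) := by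
  obtain ⟨ϖ, hϖ⟩ := exists_uniformizer_units L v
  exact ⟨(ϖ, 1), rfl, hϖ, mem_zpow_smul_torusCompactPart_iff L v ϖ hϖ 1, pairwise_disjoint_zpow_smul_torusCompactPart L v ϖ hϖ 1,
    exists_zpow_mul_of_nonsplit L v hns ϖ hϖ 1, fun n hn => zpow_notMem_torusCompactPart L v ϖ hϖ 1 hn⟩

/-! ## §4 «TOR★» PACKAGED: every (TOR) clause of ★ p849227 `stSupportFiniteSqInt_of_carpet` (tree :340–:347, VERBATIM with `Mc :=` the term of record) for ANY Borel
Haar measure `μM` on `M` at a non-split `v` — HAND 1 (★ p849333) and HAND 2 (this file) assembled -/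

/-- **«TOR★» — THE SPLIT-TORUS DATA OF ★ p849140 ∕ ★ p849227 CONSTRUCTED**: at a NON-SPLIT `v`, for the Borel structure and ANY Haar measure `μM` on
`M = E_vˣ × E¹_v`, there is a ray generator `a` (`= (ϖ, 1)`) such that, with `M_c := 𝒪_vˣ × E¹_v` (the term of record of ★ p849333), ALL NINE (TOR) clauses of
★ `F0P3cStCharTSSaHead.stSupportFiniteSqInt_of_carpet` hold — the clause texts below are the tree's (`Theorems/F0P3cStCharTSSaHead.lean` :340–:347) with the
binder `Mc` replaced by that term: `M_c` measurable ∕ compact ∕ of finite ∕ positive measure (★ HAND 1), shells pairwise disjoint and covering (§3), `ω`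
measure-preserving and a measurable embedding (§2), `ω(M_c) ⊆ M_c` (★ HAND 1).  Consumer pattern: `obtain ⟨a, hMc, hMccpt, hMcfin, hMcpos, hdisj, hgen, hωpres,
hωemb, hωMc⟩ := tor_of_nonsplit L v hns μM`. [cite: Rogawski1990, §12.7 L. 12.7.2 (proof) p. 193; L. 12.7.1 (proof) p. 191; §12.2 p. 173] [cite: WeilBNT1967, Ch. I §4] -/
theorem tor_of_nonsplit (hns : ∀ w : PlacesOver L v, IsCMField.complexConj L • w.1 = w.1)
    [MeasurableSpace ((UnitaryGroup.LocalRing L v)ˣ × ↥(normOneUnits (conjLocal L (IsCMField.complexConj L) v)))] [BorelSpace ((UnitaryGroup.LocalRing L v)ˣ × ↥(normOneUnits (conjLocal L (IsCMField.complexConj L) v)))] (μM : Measure ((UnitaryGroup.LocalRing L v)ˣ × ↥(normOneUnits (conjLocal L (IsCMField.complexConj L) v)))) [μM.IsHaarMeasure] :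
    ∃ a : ((UnitaryGroup.LocalRing L v)ˣ × ↥(normOneUnits (conjLocal L (IsCMField.complexConj L) v))),
      MeasurableSet (((Submonoid.pi Set.univ (fun w : PlacesOver L v => (w.1.adicCompletionIntegers L).toSubring.toSubmonoid)).units.prod (⊤ : Subgroup ↥(normOneUnits (conjLocal L (IsCMField.complexConj L) v)))) : Set ((UnitaryGroup.LocalRing L v)ˣ × ↥(normOneUnits (conjLocal L (IsCMField.complexConj L) v)))) ∧
      IsCompact (((Submonoid.pi Set.univ (fun w : PlacesOver L v => (w.1.adicCompletionIntegers L).toSubring.toSubmonoid)).units.prod (⊤ : Subgroup ↥(normOneUnits (conjLocal L (IsCMField.complexConj L) v)))) : Set ((UnitaryGroup.LocalRing L v)ˣ × ↥(normOneUnits (conjLocal L (IsCMField.complexConj L) v)))) ∧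
      μM (((Submonoid.pi Set.univ (fun w : PlacesOver L v => (w.1.adicCompletionIntegers L).toSubring.toSubmonoid)).units.prod (⊤ : Subgroup ↥(normOneUnits (conjLocal L (IsCMField.complexConj L) v)))) : Set ((UnitaryGroup.LocalRing L v)ˣ × ↥(normOneUnits (conjLocal L (IsCMField.complexConj L) v)))) < ⊤ ∧
      0 < μM.real (((Submonoid.pi Set.univ (fun w : PlacesOver L v => (w.1.adicCompletionIntegers L).toSubring.toSubmonoid)).units.prod (⊤ : Subgroup ↥(normOneUnits (conjLocal L (IsCMField.complexConj L) v)))) : Set ((UnitaryGroup.LocalRing L v)ˣ × ↥(normOneUnits (conjLocal L (IsCMField.complexConj L) v)))) ∧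
      Pairwise (Function.onFun Disjoint fun n : ℤ => (a ^ n) • (((Submonoid.pi Set.univ (fun w : PlacesOver L v => (w.1.adicCompletionIntegers L).toSubring.toSubmonoid)).units.prod (⊤ : Subgroup ↥(normOneUnits (conjLocal L (IsCMField.complexConj L) v)))) : Set ((UnitaryGroup.LocalRing L v)ˣ × ↥(normOneUnits (conjLocal L (IsCMField.complexConj L) v))))) ∧
      (∀ m : ((UnitaryGroup.LocalRing L v)ˣ × ↥(normOneUnits (conjLocal L (IsCMField.complexConj L) v))), ∃ (n : ℤ) (u : ((UnitaryGroup.LocalRing L v)ˣ × ↥(normOneUnits (conjLocal L (IsCMField.complexConj L) v)))), u ∈ ((Submonoid.pi Set.univ (fun w : PlacesOver L v => (w.1.adicCompletionIntegers L).toSubring.toSubmonoid)).units.prod (⊤ : Subgroup ↥(normOneUnits (conjLocal L (IsCMField.complexConj L) v)))) ∧ m = a ^ n * u) ∧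
      MeasurePreserving (fun p : ((UnitaryGroup.LocalRing L v)ˣ × ↥(normOneUnits (conjLocal L (IsCMField.complexConj L) v))) => ((Units.map ((conjLocal L (IsCMField.complexConj L) v : UnitaryGroup.LocalRing L v →+* UnitaryGroup.LocalRing L v) : UnitaryGroup.LocalRing L v →* UnitaryGroup.LocalRing L v) p.1)⁻¹, p.2)) μM μM ∧
      MeasurableEmbedding (fun p : ((UnitaryGroup.LocalRing L v)ˣ × ↥(normOneUnits (conjLocal L (IsCMField.complexConj L) v))) => ((Units.map ((conjLocal L (IsCMField.complexConj L) v : UnitaryGroup.LocalRing L v →+* UnitaryGroup.LocalRing L v) : UnitaryGroup.LocalRing L v →* UnitaryGroup.LocalRing L v) p.1)⁻¹, p.2)) ∧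
      (∀ u ∈ ((Submonoid.pi Set.univ (fun w : PlacesOver L v => (w.1.adicCompletionIntegers L).toSubring.toSubmonoid)).units.prod (⊤ : Subgroup ↥(normOneUnits (conjLocal L (IsCMField.complexConj L) v)))), ((Units.map ((conjLocal L (IsCMField.complexConj L) v : UnitaryGroup.LocalRing L v →+* UnitaryGroup.LocalRing L v) : UnitaryGroup.LocalRing L v →* UnitaryGroup.LocalRing L v) u.1)⁻¹, u.2) ∈ ((Submonoid.pi Set.univ (fun w : PlacesOver L v => (w.1.adicCompletionIntegers L).toSubring.toSubmonoid)).units.prod (⊤ : Subgroup ↥(normOneUnits (conjLocal L (IsCMField.complexConj L) v))))) := by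
  obtain ⟨ϖ, hϖ⟩ := exists_uniformizer_units L v
  exact ⟨(ϖ, 1), F0P3cStCharTSTorusCompactPart.measurableSet_torusCompactPart L v, F0P3cStCharTSTorusCompactPart.isCompact_torusCompactPart L v hns,
    F0P3cStCharTSTorusCompactPart.measure_torusCompactPart_lt_top L v hns μM,
    F0P3cStCharTSTorusCompactPart.measure_real_torusCompactPart_pos L v μM (F0P3cStCharTSTorusCompactPart.measure_torusCompactPart_lt_top L v hns μM),
    pairwise_disjoint_zpow_smul_torusCompactPart L v ϖ hϖ 1, exists_zpow_mul_of_nonsplit L v hns ϖ hϖ 1,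
    measurePreserving_reflect L v μM, measurableEmbedding_reflect L v, F0P3cStCharTSTorusCompactPart.reflect_mem_torusCompactPart L v hns⟩

end Summit.HodgeConjecture.HodgeConjecture.Cruxes.H413.F0P3cStCharTSTorusRay

end
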